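import Summits.AtomisticToContinuum.HydrodynamicLimit.Theses.ImplosionDichotomy
import Summits.AtomisticToContinuum.HydrodynamicLimit.Theses.ImplosionLoophole
import Summits.AtomisticToContinuum.HydrodynamicLimit.Theorems.ImplosionDichotomyEosContinuity
import Summits.AtomisticToContinuum.HydrodynamicLimit.Theorems.DiluteSelfConsistency.Negative.Tightness
import Summits.AtomisticToContinuum.HydrodynamicLimit.Theorems.DenseExcursion.Negative.Dichotomy
import Literature.MathematicalPhysics.KineticTheory.HardSphereEulerContinuousDependenceProofs
import Literature.MathematicalPhysics.KineticTheory.HardSphereEulerLocalExistence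
import Literature.MathematicalPhysics.KineticTheory.HardSphereEulerContinuationHolds
import Literature.MathematicalPhysics.KineticTheory.HardSphereEulerClassicalUniqueness
import Literature.Analysis.FluidPDE.CompressibleEulerHomogeneousEnergyDefs
import Literature.MathematicalPhysics.KineticTheory.HardSphereEulerUniformDerivEnergy
import Summits.AtomisticToContinuum.HydrodynamicLimit.Theorems.ImplosionDichotomyDiluteSelfConsistencyNoIdealDevelopmentTrivial
import Summits.AtomisticToContinuum.HydrodynamicLimit.Theorems.ImplosionDichotomyDiluteSelfConsistencyDerivEnergyDataBound
import Summits.AtomisticToContinuum.HydrodynamicLimit.Theorems.ImplosionDichotomyDiluteSelfConsistencySmallnessInterpolation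
import Summits.AtomisticToContinuum.HydrodynamicLimit.Theorems.ImplosionDichotomyDiluteSelfConsistencyStabilityEstimate
import Literature.Analysis.FunctionSpaces.TorusSpaceTime

/-!
# Birth skeleton (BC3), rev c3 — crux `DiluteSelfConsistency` (stmt-AtomisticToContinuum-3091)

Route `ImplosionDichotomy` (rank-3 crux; shared decl, `Iff.rfl`-equal copies in 17 Theses files, the ledger's
default copy being `Theses.ImplosionLoophole.DiluteSelfConsistency`). Registrar: planner-skel-stmt-AtomisticToContinuum-3091-0
(rev 0); lead c1 landed the exact ideal-fate cut (p138596); lead c2 the smooth reduction and the Case-I islands (rev c2',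
stubs `stub_boundedIdealDiluteSmooth` / `stub_unboundedIdealDiluteSmooth`, both blocked: Case II ⊇ ¬`DenseExcursion`
= stmt-12586, open; Case I `stub-blocked: hsEuler_continuousDependence`).

## Rev c3 (lead c3, prover-line-stmt-AtomisticToContinuum-3091-c3-0): the TIME-LOCALISATION of the crux

The cut of the crux-strategist r1 (`Cruxes/DiluteSelfConsistency/StrategistSketchR1.lean` §B, glue `dsc_of_timeSplit`
proved there; candidate B of `STRATEGY-CENSUS.md` §R1.2 — "the honest LOCALISATION of the crux"), made RUNNABLE: its
middle piece B.1 (`PreSingularDiluteness`) is a theorem from the route support `EosContinuity` (stmt-12589), which has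
the LANDED conditional closer `eosContinuity_proof : hsEuler_continuousDependence → EosContinuity`; and the named fact
`hsEuler_continuousDependence` (Kato 1975 Thm III for the hard-sphere Euler family, TAKEN by this lead:
`ledger fact claim … --from stmt-…-3091`) is reduced in the tree to four layers
(`hsEuler_continuousDependence_of_localTheory`) of which (1) `hsEuler_localExistence_holds`,
(2) `hsEuler_continuation_holds`, (3) `hsEuler_uniqueness_smallPacking` are PROVED — only layer 4, the
fixed-horizon a-priori stability estimate `hstab`, is missing. Rev c3 registers layer 4 as three analytic stubs plus
the lead's assembly stub, so that B.1 becomes a theorem of the skeleton: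

* `stub_noIdealDevelopmentTrivial` (B.0; provable now) — profiles carrying NO ideal classical development on a nonempty
  interval are DSC-trivial (smooth profiles have one by `idealGasEuler_localExistence_quant_holds`; non-smooth ones
  carry no σ-solution with the pinned data, `stub_nonsmoothVacuous` p140721 + `density_zero_eq_rhoLim`).
* `stub_smallnessInterpolation` (layer 4a; pure function spaces, provable now) — a smooth function on `𝕋³` that is
  SMALL in `L²` and BOUNDED in `H³` is small in `C¹` (integration by parts `‖∂f‖₂² ≤ ‖f‖₂‖∂²f‖₂`,
  `H²(𝕋³) ⊂ L^∞` `Torus.exists_norm_sq_le_sobolev_two`, Morrey `q = 4` `Torus.enorm_le_of_hasZeroMean` +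
  Ladyzhenskaya `Torus.integral_norm_pow_four_le_of_hasZeroMean` for the zero-mean derivatives).
* `stub_uniformDerivEnergy` (layer 4b; provable now) — the σ-UNIFORM homogeneous `H³` energy inequality for classical
  hard-sphere Euler solutions in a state box with a `C¹` bound, on any horizon: `D₃(t) ≤ C e^{κt} D₃(0)`
  (`CompressibleEuler.derivLevelEnergy_three_le` with the σ-uniform coefficients
  `HsEulerUniform.exists_uniform_coefficient_bounds`; the near-constant special case is the landed
  `ConeLocalisation.Bubble.energyHyp_holds`).
* `stub_derivEnergyDataBound` (layer 4c; provable now) — `D₃` of a smooth slice is bounded by `200 B²` when all its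
  nested partial derivatives of orders `1..3` are bounded by `B` pointwise.
* `stub_stabilityEstimate` (layer 4d, the lead's) — 4a → 4b → 4c → `hstab`: the bootstrap (continuity principle
  `HsEulerCalc.bootstrap_of_continuousOn`) on the sup norms of `V - V₁` and `∂(V - V₁)`; the difference is small in
  `L²` by the LEVEL-0 two-equation-of-state relative-energy balance `HsEulerStability.hsEuler_relativeEnergy_balance_two_eos`
  + the Grönwall shell `HsEulerCalc.torus_energy_le_of_balance` (forcing `O(σ³)` from the equation-of-state defect),
  bounded in `H³` by 4b applied to the σ-solution ALONE (rate from the `C¹` bound `‖V₁‖_{C¹} + 1` of the bootstrap)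
  + 4c, hence small in `C¹` by 4a — which closes the bootstrap on the whole horizon `[0, T']`, `T' < T₁`. No
  high-order energy of the DIFFERENCE is needed (the reference is `C^∞`, so the loss of derivatives is absorbed).
* `stub_postWindowDilute` (B.2, decision-bearing) — σ-uniform density control AT AND BEYOND the ideal first
  singularity: for every ideal classical development on `[0, T₁)` a window start `T₂ < T₁` and a threshold below
  which every admissible σ-solution is dilute on `(T₂, T)`. At a tuned implosion profile this is exactly
  `¬DenseExcursion` in substance (landed `not_denseExcursion_iff_diluteSelfConsistency`): decided by stmt-12586
  (lead a2 live, line sonic-cavity-renewal) and by nothing inside this line.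
* Composition (sorry-free): `hstab` ⇒ `hsEuler_continuousDependence` (layers 1–3 from the tree) ⇒ `EosContinuity`
  (`eosContinuity_proof`) ⇒ B.1 (sup of the ideal density on the compact slab `[0,T₂] × 𝕋³`, EOS continuity with
  tolerance `1`, `(C+1)σ³ < η`) ⇒ with B.0 and B.2, `DiluteSelfConsistency` by the time split (pick an ideal
  development if there is one; B.2's window and threshold; B.1 on `[0, T₂]`; the minimum).

What rev c3 settles when its provable stubs land: **the crux can only fail at or after the first singular time of the
ideal development** — the localisation every census asserted informally, as a theorem; and Case I's blocker
`hsEuler_continuousDependence` becomes a proved fact (finite windows).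

## Disproof used (`Cruxes/DiluteSelfConsistency/Disproof.lean`, cdisprove cycle 1 v2 — read first, 07:0xZ)

§0 `dsc_iff_not_denseExcursion`: honoured — B.2 is where `¬DenseExcursion` lives, named as such. §1 load-bearing map:
B.0/B.1/B.2 keep `0 < η`, `a₀ > 0`, `θ₀ > 0` and the tie; `σ₀` depends on `η`, the profiles AND the window
(`not_…LevelUniform / ProfileUniform` respected); no stub asserts a σ-uniform density bound or a rate
(`not_…BoundedDensity / PolynomialRate`). §1b AlexanderRange: every threshold is small. §2b `sigma0_pow_le`: B.1's
threshold `σ₀ ≤ η/(C+1)` obeys it. No `-- Targets` section exists as of rev c3.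
-/

noncomputable section

namespace Summit.AtomisticToContinuum.HydrodynamicLimit.Cruxes.DiluteSelfConsistency.Birth

open MeasureTheory Filter Set Topology
open Literature.MathematicalPhysics.KineticTheory Literature.Analysis.FluidPDE Literature.Analysis.FunctionSpaces
open Summit.AtomisticToContinuum.HydrodynamicLimit.Theses.ImplosionDichotomy
open Summit.AtomisticToContinuum.HydrodynamicLimit.Theorems
open Summit.AtomisticToContinuum.HydrodynamicLimit.Theorems.DenseExcursionDichotomy (tendstoHydroFieldsAt_zero_transfer)

/-! ## The registered stubs -/

/-- **Stub B.0 (no ideal development ⇒ trivial).** For every level `η > 0` and all continuous positive profiles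
`(a₀, θ₀, u₀)` whose reference data `(a₀/∫a₀, u₀, θ₀)` launch NO ideal-gas (`σ = 0`) classical solution on any
nonempty `[0, T₁)`, there is `σ₀ > 0` with `DiluteSelfConsistencyHoldsAt η a₀ θ₀ u₀ σ₀`. (Smooth profiles always have
an ideal development — `idealGasEuler_localExistence_quant_holds` — so the hypothesis forces a non-smooth profile, and
then below the threshold of `stub_nonsmoothVacuous` no classical σ-solution with the tied data lives on a nonempty
interval: `density_zero_eq_rhoLim` identifies the tied density datum with `rhoLim (profileOf a₀) σ`, the velocity and
temperature data with `u₀, θ₀`.) [folklore] -/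
theorem stub_noIdealDevelopmentTrivial :
    ∀ η : ℝ, 0 < η → ∀ (a₀ θ₀ : T3 → ℝ) (u₀ : T3 → V3), Continuous a₀ → Continuous θ₀ → Continuous u₀ →
      (∀ x, 0 < a₀ x) → (∀ x, 0 < θ₀ x) →
      (¬ ∃ (T₁ : ℝ) (ρ₁ θ₁ : ℝ → T3 → ℝ) (u₁ : ℝ → T3 → V3), 0 < T₁ ∧ IsHardSphereEulerSolution 0 T₁ ρ₁ u₁ θ₁ ∧
          (∀ x, ρ₁ 0 x = a₀ x / ∫ y, a₀ y) ∧ u₁ 0 = u₀ ∧ θ₁ 0 = θ₀) →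
      ∃ σ₀ : ℝ, 0 < σ₀ ∧ DiluteSelfConsistencyHoldsAt η a₀ θ₀ u₀ σ₀ :=
  -- LANDED (p148786, `Theorems/ImplosionDichotomyDiluteSelfConsistencyNoIdealDevelopmentTrivial.lean`, wave 1)
  Summit.AtomisticToContinuum.HydrodynamicLimit.Theorems.stub_noIdealDevelopmentTrivial

/-- **Stub 4a (smallness interpolation on `𝕋³`).** For every `H³`-size `E` and every `ε > 0` there is `δ > 0` such
that every smooth real function on `𝕋³` with `∫ f² ≤ δ` and all `L²` norms of its nested partial derivatives of
orders `1, 2, 3` at most `E` satisfies `|f| ≤ ε` and `|∂ᵢ f| ≤ ε` pointwise. (Interpolation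
`‖∂ᵢf‖₂² ≤ ‖f‖₂ ‖∂ᵢ∂ᵢf‖₂`, `‖∂ᵢ∂ⱼf‖₂² ≤ ‖∂ⱼf‖₂ ‖∂ᵢ∂ᵢ∂ⱼf‖₂` by parts; `H²(𝕋³) ⊂ L^∞`; for `∂ᵢf`, which has
zero mean, Morrey with `q = 4` and Ladyzhenskaya's inequality for the zero-mean second derivatives.) [folklore] -/
theorem stub_smallnessInterpolation :
    ∀ E ε : ℝ, 0 < ε → ∃ δ : ℝ, 0 < δ ∧ ∀ f : T3 → ℝ, Torus.IsSmooth f →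
      (∫ x, f x ^ 2) ≤ δ →
      (∀ i : Fin 3, (∫ x, Torus.partialDeriv i f x ^ 2) ≤ E) →
      (∀ i j : Fin 3, (∫ x, Torus.partialDeriv i (Torus.partialDeriv j f) x ^ 2) ≤ E) →
      (∀ i j l : Fin 3, (∫ x, Torus.partialDeriv i (Torus.partialDeriv j (Torus.partialDeriv l f)) x ^ 2) ≤ E) →
      ∀ x, |f x| ≤ ε ∧ ∀ i : Fin 3, |Torus.partialDeriv i f x| ≤ ε :=
  -- LANDED (p148552 Literature `Torus.smallness_interpolation_three` + wrapper p149894, wave 1)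
  Summit.AtomisticToContinuum.HydrodynamicLimit.Theorems.stub_smallnessInterpolation

/-- **Stub 4b (σ-uniform homogeneous `H³` energy inequality in a state box).** Under the equation-of-state hypothesis
of `hsEuler_localExistence`, for every state bound `M ≥ 1` and `C¹` bound `Λ ≥ 1` there are a packing threshold
`ηP > 0`, a prefactor `C ≥ 1` and a rate `κ ≥ 0` — chosen BEFORE the reduced diameter — such that for every `σ > 0`
every classical hard-sphere Euler solution on `[0, T) × 𝕋³` with `M⁻¹ ≤ ρ, θ ≤ M`, `‖u‖ ≤ Λ`, packing `ρσ³ ≤ ηP`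
and first derivatives `≤ Λ` obeys `D₃(t) ≤ C e^{κ t} D₃(0)` (`D₃ = CompressibleEuler.derivLevelEnergy … 3`, the
derivative-only `H³` energy). Majda's `H³` energy method with the explicit constants of
`CompressibleEuler.derivLevelEnergy_three_le` and the σ-uniform coefficient bounds of
`HsEulerUniform.exists_uniform_coefficient_bounds`. [cite: Majda1984, Ch. 2 §2.1 Thm 2.2 (2.38)] -/
theorem stub_uniformDerivEnergy :
    ∀ η₀ : ℝ, 0 < η₀ → ∀ F : ℝ → ℝ, AnalyticOnNhd ℝ F (Ioo (-η₀) η₀) →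
      EqOn hsExcessFreeEnergy F (Ico 0 η₀) →
      ∀ M Λ : ℝ, 1 ≤ M → 1 ≤ Λ → ∃ ηP C κ : ℝ, 0 < ηP ∧ 1 ≤ C ∧ 0 ≤ κ ∧
        ∀ σ : ℝ, 0 < σ → ∀ T : ℝ, 0 < T →
        ∀ (ρ θ : ℝ → T3 → ℝ) (u : ℝ → T3 → V3), IsHardSphereEulerSolution σ T ρ u θ →
        (∀ t ∈ Ico 0 T, ∀ x, M⁻¹ ≤ ρ t x ∧ ρ t x ≤ M ∧ M⁻¹ ≤ θ t x ∧ θ t x ≤ M ∧ ‖u t x‖ ≤ Λ ∧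
            ρ t x * σ ^ 3 ≤ ηP ∧
            ∀ i : Fin 3, |Torus.partialDeriv i (ρ t) x| ≤ Λ ∧ ‖Torus.partialDeriv i (u t) x‖ ≤ Λ ∧
              |Torus.partialDeriv i (θ t) x| ≤ Λ) →
        ∀ t ∈ Ico 0 T,
          CompressibleEuler.derivLevelEnergy ρ u θ 3 t ≤
            C * Real.exp (κ * t) * CompressibleEuler.derivLevelEnergy ρ u θ 3 0 :=
  -- LANDED (p148149, `Literature/MathematicalPhysics/KineticTheory/HardSphereEulerUniformDerivEnergy.lean`, wave 1)
  hsEuler_uniformDerivEnergy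

/-- **Stub 4c (the derivative energy of a slice with bounded derivatives).** If all nested partial derivatives of
orders `1 ≤ |w| ≤ 3` of the slices `ρ t, u t, θ t` are bounded by `B` pointwise, then
`CompressibleEuler.derivLevelEnergy ρ u θ 3 t ≤ 200 B²` (`39` words, three fields, unit volume). [folklore] -/
theorem stub_derivEnergyDataBound :
    ∀ (ρ θ : ℝ → T3 → ℝ) (u : ℝ → T3 → V3) (t B : ℝ), 0 ≤ B →
      Torus.IsSmooth (ρ t) → Torus.IsSmooth (θ t) → Torus.IsSmooth (u t) →
      (∀ w : List (Fin 3), 1 ≤ w.length → w.length ≤ 3 → ∀ x,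
          |Torus.iterPartialDeriv w (ρ t) x| ≤ B ∧ ‖Torus.iterPartialDeriv w (u t) x‖ ≤ B ∧
            |Torus.iterPartialDeriv w (θ t) x| ≤ B) →
      CompressibleEuler.derivLevelEnergy ρ u θ 3 t ≤ 200 * B ^ 2 :=
  -- LANDED (p148115 Literature `CompressibleEuler.derivLevelEnergy_three_le_of_pointwise` + wrapper p148917, wave 1)
  Summit.AtomisticToContinuum.HydrodynamicLimit.Theorems.stub_derivEnergyDataBound

/-- **Stub 4d (layer 4 of Kato's Thm III for the hard-sphere family: the fixed-horizon a-priori stability estimate,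
from 4a–4c).** Given smallness interpolation (4a), the σ-uniform `H³` inequality (4b) and the data bound (4c): under the
equation-of-state hypothesis, for every ideal-gas reference solution on `[0, T₁)`, every `0 < T' < T₁` and `ε > 0`
there are `k`, `δ > 0`, `M > 0` such that for `0 < σ < δ` and smooth positive data `δ`-close in `Cᵏ` to the reference
data, EVERY classical σ-solution with these data on `[0, T)`, `T ≤ T'`, obeys `M⁻¹ ≤ ρ, θ ≤ M`, `‖u‖ ≤ M`,
`|∂ᵢ(ρ, u, θ)| ≤ M` and is `ε`-close to the reference pointwise on `[0, T) × 𝕋³` — verbatim the hypothesis `hstab`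
of `hsEuler_continuousDependence_of_localTheory`. Proof: continuity principle on the sup norms of the difference and
of its first derivatives; `L²`-smallness of the difference from the level-0 two-equation-of-state relative-energy
balance + Grönwall (forcing `O(σ³)`); `H³`-boundedness from 4b–4c along the σ-solution alone; `C¹`-smallness by 4a.
[cite: Kato1975, Thm III] [cite: Majda1984, Ch. 2 §2.1 Thm 2.2] -/
theorem stub_stabilityEstimate :
    (∀ E ε : ℝ, 0 < ε → ∃ δ : ℝ, 0 < δ ∧ ∀ f : T3 → ℝ, Torus.IsSmooth f →
      (∫ x, f x ^ 2) ≤ δ →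
      (∀ i : Fin 3, (∫ x, Torus.partialDeriv i f x ^ 2) ≤ E) →
      (∀ i j : Fin 3, (∫ x, Torus.partialDeriv i (Torus.partialDeriv j f) x ^ 2) ≤ E) →
      (∀ i j l : Fin 3, (∫ x, Torus.partialDeriv i (Torus.partialDeriv j (Torus.partialDeriv l f)) x ^ 2) ≤ E) →
      ∀ x, |f x| ≤ ε ∧ ∀ i : Fin 3, |Torus.partialDeriv i f x| ≤ ε) →
    (∀ η₀ : ℝ, 0 < η₀ → ∀ F : ℝ → ℝ, AnalyticOnNhd ℝ F (Ioo (-η₀) η₀) →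
      EqOn hsExcessFreeEnergy F (Ico 0 η₀) →
      ∀ M Λ : ℝ, 1 ≤ M → 1 ≤ Λ → ∃ ηP C κ : ℝ, 0 < ηP ∧ 1 ≤ C ∧ 0 ≤ κ ∧
        ∀ σ : ℝ, 0 < σ → ∀ T : ℝ, 0 < T →
        ∀ (ρ θ : ℝ → T3 → ℝ) (u : ℝ → T3 → V3), IsHardSphereEulerSolution σ T ρ u θ →
        (∀ t ∈ Ico 0 T, ∀ x, M⁻¹ ≤ ρ t x ∧ ρ t x ≤ M ∧ M⁻¹ ≤ θ t x ∧ θ t x ≤ M ∧ ‖u t x‖ ≤ Λ ∧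
            ρ t x * σ ^ 3 ≤ ηP ∧
            ∀ i : Fin 3, |Torus.partialDeriv i (ρ t) x| ≤ Λ ∧ ‖Torus.partialDeriv i (u t) x‖ ≤ Λ ∧
              |Torus.partialDeriv i (θ t) x| ≤ Λ) →
        ∀ t ∈ Ico 0 T,
          CompressibleEuler.derivLevelEnergy ρ u θ 3 t ≤
            C * Real.exp (κ * t) * CompressibleEuler.derivLevelEnergy ρ u θ 3 0) →
    (∀ (ρ θ : ℝ → T3 → ℝ) (u : ℝ → T3 → V3) (t B : ℝ), 0 ≤ B →
      Torus.IsSmooth (ρ t) → Torus.IsSmooth (θ t) → Torus.IsSmooth (u t) →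
      (∀ w : List (Fin 3), 1 ≤ w.length → w.length ≤ 3 → ∀ x,
          |Torus.iterPartialDeriv w (ρ t) x| ≤ B ∧ ‖Torus.iterPartialDeriv w (u t) x‖ ≤ B ∧
            |Torus.iterPartialDeriv w (θ t) x| ≤ B) →
      CompressibleEuler.derivLevelEnergy ρ u θ 3 t ≤ 200 * B ^ 2) →
    ∀ η₀ : ℝ, 0 < η₀ → ∀ F : ℝ → ℝ, AnalyticOnNhd ℝ F (Ioo (-η₀) η₀) →
      EqOn hsExcessFreeEnergy F (Ico 0 η₀) →
      ∀ (T₁ : ℝ) (ρ₁ θ₁ : ℝ → T3 → ℝ) (u₁ : ℝ → T3 → V3), IsHardSphereEulerSolution 0 T₁ ρ₁ u₁ θ₁ →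
        ∀ T' : ℝ, 0 < T' → T' < T₁ → ∀ ε : ℝ, 0 < ε →
        ∃ k : ℕ, ∃ δ M : ℝ, 0 < δ ∧ 0 < M ∧ ∀ σ : ℝ, 0 < σ → σ < δ →
          ∀ (ρ₀ θ₀ : T3 → ℝ) (u₀ : T3 → V3),
            Torus.IsSmooth ρ₀ → Torus.IsSmooth θ₀ → Torus.IsSmooth u₀ →
            (∀ x, 0 < ρ₀ x) → (∀ x, 0 < θ₀ x) →
            (∀ n : ℕ, n ≤ k → ∀ y : EuclideanSpace ℝ (Fin 3),
              ‖iteratedFDeriv ℝ n (Torus.lift fun x => ρ₀ x - ρ₁ 0 x) y‖ ≤ δ) →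
            (∀ n : ℕ, n ≤ k → ∀ y : EuclideanSpace ℝ (Fin 3),
              ‖iteratedFDeriv ℝ n (Torus.lift fun x => θ₀ x - θ₁ 0 x) y‖ ≤ δ) →
            (∀ n : ℕ, n ≤ k → ∀ y : EuclideanSpace ℝ (Fin 3),
              ‖iteratedFDeriv ℝ n (Torus.lift fun x => u₀ x - u₁ 0 x) y‖ ≤ δ) →
            ∀ T : ℝ, T ≤ T' → ∀ (ρ θ : ℝ → T3 → ℝ) (u : ℝ → T3 → V3),
              IsHardSphereEulerSolution σ T ρ u θ → ρ 0 = ρ₀ → u 0 = u₀ → θ 0 = θ₀ →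
              ∀ t ∈ Ico 0 T, ∀ x,
                (M⁻¹ ≤ ρ t x ∧ ρ t x ≤ M ∧ M⁻¹ ≤ θ t x ∧ θ t x ≤ M ∧ ‖u t x‖ ≤ M ∧
                  ∀ i : Fin 3, ‖Torus.partialDeriv i (u t) x‖ ≤ M ∧
                    |Torus.partialDeriv i (ρ t) x| ≤ M ∧ |Torus.partialDeriv i (θ t) x| ≤ M) ∧
                (|ρ t x - ρ₁ t x| < ε ∧ ‖u t x - u₁ t x‖ < ε ∧ |θ t x - θ₁ t x| < ε) :=
  -- LANDED (lead c3: Literature p149606 `hsEuler_twoEos_level0_stability` + p149607 `stabilityEstimate_of_level0` + wrapper p150270)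
  Summit.AtomisticToContinuum.HydrodynamicLimit.Theorems.stub_stabilityEstimate

/-- **Stub B.2 (post-window diluteness; decision-bearing).** For every level `η > 0`, all continuous positive profiles
and every ideal classical development of the reference data on a nonempty `[0, T₁)` there are a window start
`T₂ ∈ (0, T₁)` and a threshold `σ₀ > 0` such that for `0 < σ < σ₀` every classical σ-solution tied to the local Gibbs
data at `t = 0` has packing `ρ_t(x)σ³ < η` for all `t ∈ (T₂, T)` — σ-uniform density control AT AND BEYOND the ideal
first singularity. Expected FALSE at tuned implosion thresholds, where it is `¬DenseExcursion` in substance (landed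
`not_denseExcursion_iff_diluteSelfConsistency`); decided by stmt-AtomisticToContinuum-12586.
[cite: CaolaboraEtAl2025, Thm 1.2] [cite: MerleEtAl2022] -/
theorem stub_postWindowDilute :
    ∀ η : ℝ, 0 < η → ∀ (a₀ θ₀ : T3 → ℝ) (u₀ : T3 → V3), Continuous a₀ → Continuous θ₀ → Continuous u₀ →
      (∀ x, 0 < a₀ x) → (∀ x, 0 < θ₀ x) →
      ∀ (T₁ : ℝ) (ρ₁ θ₁ : ℝ → T3 → ℝ) (u₁ : ℝ → T3 → V3), 0 < T₁ → IsHardSphereEulerSolution 0 T₁ ρ₁ u₁ θ₁ →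
        (∀ x, ρ₁ 0 x = a₀ x / ∫ y, a₀ y) → u₁ 0 = u₀ → θ₁ 0 = θ₀ →
        ∃ T₂ : ℝ, 0 < T₂ ∧ T₂ < T₁ ∧ ∃ σ₀ : ℝ, 0 < σ₀ ∧ ∀ σ : ℝ, 0 < σ → σ < σ₀ →
          ∀ (T : ℝ) (ρ θ : ℝ → T3 → ℝ) (u : ℝ → T3 → V3), IsHardSphereEulerSolution σ T ρ u θ →
            ∀ Φ : (N : ℕ) → HardSphereFlow (Torus.geometry (Fin 3)) (hsDiameter σ N) (N + 1),
              TendstoHydroFieldsAt (fun N => localGibbsLaw σ a₀ u₀ θ₀ N (Φ N)) Φ ρ u θ 0 →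
                ∀ t ∈ Ico 0 T, T₂ < t → ∀ x, ρ t x * σ ^ 3 < η := by
  sorry

/-! ## The composition (sorry-free) -/

/-- **Layer 4 ⇒ Kato's continuous dependence ⇒ `EosContinuity`** (layers 1–3 and the assembly are tree theorems:
`hsEuler_localExistence_holds`, `hsEuler_continuation_holds`, `hsEuler_uniqueness_smallPacking`,
`hsEuler_continuousDependence_of_localTheory`, `eosContinuity_proof`). [cite: Kato1975, Thm III] -/
theorem eosContinuity_of_layer4
    (hS : ∀ E ε : ℝ, 0 < ε → ∃ δ : ℝ, 0 < δ ∧ ∀ f : T3 → ℝ, Torus.IsSmooth f →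
      (∫ x, f x ^ 2) ≤ δ →
      (∀ i : Fin 3, (∫ x, Torus.partialDeriv i f x ^ 2) ≤ E) →
      (∀ i j : Fin 3, (∫ x, Torus.partialDeriv i (Torus.partialDeriv j f) x ^ 2) ≤ E) →
      (∀ i j l : Fin 3, (∫ x, Torus.partialDeriv i (Torus.partialDeriv j (Torus.partialDeriv l f)) x ^ 2) ≤ E) →
      ∀ x, |f x| ≤ ε ∧ ∀ i : Fin 3, |Torus.partialDeriv i f x| ≤ ε)
    (hH : ∀ η₀ : ℝ, 0 < η₀ → ∀ F : ℝ → ℝ, AnalyticOnNhd ℝ F (Ioo (-η₀) η₀) →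
      EqOn hsExcessFreeEnergy F (Ico 0 η₀) →
      ∀ M Λ : ℝ, 1 ≤ M → 1 ≤ Λ → ∃ ηP C κ : ℝ, 0 < ηP ∧ 1 ≤ C ∧ 0 ≤ κ ∧
        ∀ σ : ℝ, 0 < σ → ∀ T : ℝ, 0 < T →
        ∀ (ρ θ : ℝ → T3 → ℝ) (u : ℝ → T3 → V3), IsHardSphereEulerSolution σ T ρ u θ →
        (∀ t ∈ Ico 0 T, ∀ x, M⁻¹ ≤ ρ t x ∧ ρ t x ≤ M ∧ M⁻¹ ≤ θ t x ∧ θ t x ≤ M ∧ ‖u t x‖ ≤ Λ ∧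
            ρ t x * σ ^ 3 ≤ ηP ∧
            ∀ i : Fin 3, |Torus.partialDeriv i (ρ t) x| ≤ Λ ∧ ‖Torus.partialDeriv i (u t) x‖ ≤ Λ ∧
              |Torus.partialDeriv i (θ t) x| ≤ Λ) →
        ∀ t ∈ Ico 0 T,
          CompressibleEuler.derivLevelEnergy ρ u θ 3 t ≤
            C * Real.exp (κ * t) * CompressibleEuler.derivLevelEnergy ρ u θ 3 0)
    (hD : ∀ (ρ θ : ℝ → T3 → ℝ) (u : ℝ → T3 → V3) (t B : ℝ), 0 ≤ B →
      Torus.IsSmooth (ρ t) → Torus.IsSmooth (θ t) → Torus.IsSmooth (u t) →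
      (∀ w : List (Fin 3), 1 ≤ w.length → w.length ≤ 3 → ∀ x,
          |Torus.iterPartialDeriv w (ρ t) x| ≤ B ∧ ‖Torus.iterPartialDeriv w (u t) x‖ ≤ B ∧
            |Torus.iterPartialDeriv w (θ t) x| ≤ B) →
      CompressibleEuler.derivLevelEnergy ρ u θ 3 t ≤ 200 * B ^ 2) :
    EosContinuity :=
  eosContinuity_proof (hsEuler_continuousDependence_of_localTheory hsEuler_localExistence_holds
    hsEuler_continuation_holds hsEuler_uniqueness_smallPacking (stub_stabilityEstimate hS hH hD))

/-- **B.1 from `EosContinuity`** (verbatim the strategist's `preSingularDiluteness_of_eosContinuity`): dilute on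
`[0, T₂]` for every `T₂` short of an ideal classical lifespan — sup of the ideal density on the compact slab
`[0, T₂] × 𝕋³`, equation-of-state continuity with tolerance `1`, `(C+1)σ³ < η` for `σ < min(1, η/(C+1))`, and the
one-flow tie is the all-flow tie. [cite: Kato1975, Thm III] [cite: Majda1984] -/
theorem preSingularDiluteness_of_eosContinuity (hE : EosContinuity) :
    ∀ η : ℝ, 0 < η → ∀ (a₀ θ₀ : T3 → ℝ) (u₀ : T3 → V3), Continuous a₀ → Continuous θ₀ → Continuous u₀ →
      (∀ x, 0 < a₀ x) → (∀ x, 0 < θ₀ x) →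
      ∀ (T₁ : ℝ) (ρ₁ θ₁ : ℝ → T3 → ℝ) (u₁ : ℝ → T3 → V3), IsHardSphereEulerSolution 0 T₁ ρ₁ u₁ θ₁ →
        (∀ x, ρ₁ 0 x = a₀ x / ∫ y, a₀ y) → u₁ 0 = u₀ → θ₁ 0 = θ₀ → ∀ T₂ : ℝ, 0 < T₂ → T₂ < T₁ →
        ∃ σ₀ : ℝ, 0 < σ₀ ∧ ∀ σ : ℝ, 0 < σ → σ < σ₀ →
          ∀ (T : ℝ) (ρ θ : ℝ → T3 → ℝ) (u : ℝ → T3 → V3), IsHardSphereEulerSolution σ T ρ u θ →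
            ∀ Φ : (N : ℕ) → HardSphereFlow (Torus.geometry (Fin 3)) (hsDiameter σ N) (N + 1),
              TendstoHydroFieldsAt (fun N => localGibbsLaw σ a₀ u₀ θ₀ N (Φ N)) Φ ρ u θ 0 →
                ∀ t ∈ Ico 0 T, t ≤ T₂ → ∀ x, ρ t x * σ ^ 3 < η := by
  -- adapted from Cruxes/DiluteSelfConsistency/StrategistSketchR1.lean (planner-cstrat-…-3091-r1-0)
  intro η hη a₀ θ₀ u₀ ha hθ hu ha0 hθ0 T₁ ρ₁ θ₁ u₁ hsol h0 hu0 hθ₀ T₂ hT₂ hT₂1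
  obtain ⟨C, hC⟩ := hsol.smooth_density.exists_norm_le_of_isCompact isCompact_Icc
    (fun t ht => ⟨ht.1, lt_of_le_of_lt ht.2 hT₂1⟩)
  have hC0 : 0 ≤ C := le_trans (norm_nonneg _) (hC 0 ⟨le_rfl, hT₂.le⟩ 0)
  obtain ⟨σ₁, hσ₁, H⟩ := hE a₀ θ₀ u₀ ha hθ hu ha0 hθ0 T₁ ρ₁ θ₁ u₁ hsol h0 hu0 hθ₀ T₂ hT₂ hT₂1 1 one_pos
  refine ⟨min σ₁ (min 1 (η / (C + 1))), lt_min hσ₁ (lt_min one_pos (div_pos hη (by linarith))), ?_⟩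
  intro σ hσ hσlt T ρ θ u hsolσ Φ htie t ht htT₂ x
  have hσ₁' : σ < σ₁ := lt_of_lt_of_le hσlt (min_le_left _ _)
  have hσ1 : σ < 1 := lt_of_lt_of_le hσlt ((min_le_right _ _).trans (min_le_left _ _))
  have hση : σ < η / (C + 1) := lt_of_lt_of_le hσlt ((min_le_right _ _).trans (min_le_right _ _))
  have hclose := (H σ hσ hσ₁').2 T ρ θ u hsolσ (fun Ψ => tendstoHydroFieldsAt_zero_transfer Φ Ψ htie)
    t ht htT₂ x
  have hρ₁ : ρ₁ t x ≤ C := le_trans (Real.le_norm_self _) (hC t ⟨ht.1, htT₂⟩ x)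
  have hρ : ρ t x < C + 1 := by
    have := (abs_lt.1 hclose).2
    linarith
  have hσ3 : σ ^ 3 ≤ σ := by
    have h1 : σ ^ 3 ≤ σ ^ 1 := pow_le_pow_of_le_one hσ.le hσ1.le (by norm_num)
    simpa using h1
  have hC1 : 0 < C + 1 := by linarith
  have hρpos : 0 < ρ t x := hsolσ.density_pos t ht x
  calc ρ t x * σ ^ 3 ≤ ρ t x * σ := mul_le_mul_of_nonneg_left hσ3 hρpos.le
    _ < (C + 1) * (η / (C + 1)) := mul_lt_mul'' hρ hση hρpos.le hσ.le
    _ = η := by field_simp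

/-- **Composition (sorry-free): B.0 → layer 4 (4a, 4b, 4c, 4d) → B.2 → `DiluteSelfConsistency`** (the payload
route's decl `Theses.ImplosionDichotomy.DiluteSelfConsistency`): layer 4 gives `EosContinuity`
(`eosContinuity_of_layer4`), hence B.1 (`preSingularDiluteness_of_eosContinuity`); then the time split — pick an
ideal development if there is one, take B.2's window start `T₂` and threshold, B.1's threshold for `[0, T₂]`, and the
minimum; otherwise B.0. [folklore] -/
theorem DiluteSelfConsistency_of
    (h0 : ∀ η : ℝ, 0 < η → ∀ (a₀ θ₀ : T3 → ℝ) (u₀ : T3 → V3), Continuous a₀ → Continuous θ₀ → Continuous u₀ →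
      (∀ x, 0 < a₀ x) → (∀ x, 0 < θ₀ x) →
      (¬ ∃ (T₁ : ℝ) (ρ₁ θ₁ : ℝ → T3 → ℝ) (u₁ : ℝ → T3 → V3), 0 < T₁ ∧ IsHardSphereEulerSolution 0 T₁ ρ₁ u₁ θ₁ ∧
          (∀ x, ρ₁ 0 x = a₀ x / ∫ y, a₀ y) ∧ u₁ 0 = u₀ ∧ θ₁ 0 = θ₀) →
      ∃ σ₀ : ℝ, 0 < σ₀ ∧ DiluteSelfConsistencyHoldsAt η a₀ θ₀ u₀ σ₀)
    (hS : ∀ E ε : ℝ, 0 < ε → ∃ δ : ℝ, 0 < δ ∧ ∀ f : T3 → ℝ, Torus.IsSmooth f →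
      (∫ x, f x ^ 2) ≤ δ →
      (∀ i : Fin 3, (∫ x, Torus.partialDeriv i f x ^ 2) ≤ E) →
      (∀ i j : Fin 3, (∫ x, Torus.partialDeriv i (Torus.partialDeriv j f) x ^ 2) ≤ E) →
      (∀ i j l : Fin 3, (∫ x, Torus.partialDeriv i (Torus.partialDeriv j (Torus.partialDeriv l f)) x ^ 2) ≤ E) →
      ∀ x, |f x| ≤ ε ∧ ∀ i : Fin 3, |Torus.partialDeriv i f x| ≤ ε)
    (hH : ∀ η₀ : ℝ, 0 < η₀ → ∀ F : ℝ → ℝ, AnalyticOnNhd ℝ F (Ioo (-η₀) η₀) →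
      EqOn hsExcessFreeEnergy F (Ico 0 η₀) →
      ∀ M Λ : ℝ, 1 ≤ M → 1 ≤ Λ → ∃ ηP C κ : ℝ, 0 < ηP ∧ 1 ≤ C ∧ 0 ≤ κ ∧
        ∀ σ : ℝ, 0 < σ → ∀ T : ℝ, 0 < T →
        ∀ (ρ θ : ℝ → T3 → ℝ) (u : ℝ → T3 → V3), IsHardSphereEulerSolution σ T ρ u θ →
        (∀ t ∈ Ico 0 T, ∀ x, M⁻¹ ≤ ρ t x ∧ ρ t x ≤ M ∧ M⁻¹ ≤ θ t x ∧ θ t x ≤ M ∧ ‖u t x‖ ≤ Λ ∧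
            ρ t x * σ ^ 3 ≤ ηP ∧
            ∀ i : Fin 3, |Torus.partialDeriv i (ρ t) x| ≤ Λ ∧ ‖Torus.partialDeriv i (u t) x‖ ≤ Λ ∧
              |Torus.partialDeriv i (θ t) x| ≤ Λ) →
        ∀ t ∈ Ico 0 T,
          CompressibleEuler.derivLevelEnergy ρ u θ 3 t ≤
            C * Real.exp (κ * t) * CompressibleEuler.derivLevelEnergy ρ u θ 3 0)
    (hD : ∀ (ρ θ : ℝ → T3 → ℝ) (u : ℝ → T3 → V3) (t B : ℝ), 0 ≤ B →
      Torus.IsSmooth (ρ t) → Torus.IsSmooth (θ t) → Torus.IsSmooth (u t) →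
      (∀ w : List (Fin 3), 1 ≤ w.length → w.length ≤ 3 → ∀ x,
          |Torus.iterPartialDeriv w (ρ t) x| ≤ B ∧ ‖Torus.iterPartialDeriv w (u t) x‖ ≤ B ∧
            |Torus.iterPartialDeriv w (θ t) x| ≤ B) →
      CompressibleEuler.derivLevelEnergy ρ u θ 3 t ≤ 200 * B ^ 2)
    (h2 : ∀ η : ℝ, 0 < η → ∀ (a₀ θ₀ : T3 → ℝ) (u₀ : T3 → V3), Continuous a₀ → Continuous θ₀ → Continuous u₀ →
      (∀ x, 0 < a₀ x) → (∀ x, 0 < θ₀ x) →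
      ∀ (T₁ : ℝ) (ρ₁ θ₁ : ℝ → T3 → ℝ) (u₁ : ℝ → T3 → V3), 0 < T₁ → IsHardSphereEulerSolution 0 T₁ ρ₁ u₁ θ₁ →
        (∀ x, ρ₁ 0 x = a₀ x / ∫ y, a₀ y) → u₁ 0 = u₀ → θ₁ 0 = θ₀ →
        ∃ T₂ : ℝ, 0 < T₂ ∧ T₂ < T₁ ∧ ∃ σ₀ : ℝ, 0 < σ₀ ∧ ∀ σ : ℝ, 0 < σ → σ < σ₀ →
          ∀ (T : ℝ) (ρ θ : ℝ → T3 → ℝ) (u : ℝ → T3 → V3), IsHardSphereEulerSolution σ T ρ u θ →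
            ∀ Φ : (N : ℕ) → HardSphereFlow (Torus.geometry (Fin 3)) (hsDiameter σ N) (N + 1),
              TendstoHydroFieldsAt (fun N => localGibbsLaw σ a₀ u₀ θ₀ N (Φ N)) Φ ρ u θ 0 →
                ∀ t ∈ Ico 0 T, T₂ < t → ∀ x, ρ t x * σ ^ 3 < η) :
    Summit.AtomisticToContinuum.HydrodynamicLimit.Theses.ImplosionDichotomy.DiluteSelfConsistency := by
  have h1 := preSingularDiluteness_of_eosContinuity (eosContinuity_of_layer4 hS hH hD)
  -- adapted from `StrategistR1.dsc_of_timeSplit` (Cruxes/DiluteSelfConsistency/StrategistSketchR1.lean)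
  intro η hη a₀ θ₀ u₀ ha hθ hu ha0 hθ0
  by_cases hdev : ∃ (T₁ : ℝ) (ρ₁ θ₁ : ℝ → T3 → ℝ) (u₁ : ℝ → T3 → V3), 0 < T₁ ∧
      IsHardSphereEulerSolution 0 T₁ ρ₁ u₁ θ₁ ∧ (∀ x, ρ₁ 0 x = a₀ x / ∫ y, a₀ y) ∧ u₁ 0 = u₀ ∧ θ₁ 0 = θ₀
  · obtain ⟨T₁, ρ₁, θ₁, u₁, hT₁, hsol, hd, hu0, hθ0'⟩ := hdev
    obtain ⟨T₂, hT₂, hT₂1, σ₂, hσ₂, H2⟩ :=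
      h2 η hη a₀ θ₀ u₀ ha hθ hu ha0 hθ0 T₁ ρ₁ θ₁ u₁ hT₁ hsol hd hu0 hθ0'
    obtain ⟨σ₁, hσ₁, H1⟩ := h1 η hη a₀ θ₀ u₀ ha hθ hu ha0 hθ0 T₁ ρ₁ θ₁ u₁ hsol hd hu0 hθ0' T₂ hT₂ hT₂1
    refine ⟨min σ₁ σ₂, lt_min hσ₁ hσ₂, ?_⟩
    intro σ hσ hσlt T ρ θ u hE Φ htie t ht x
    by_cases htT : t ≤ T₂
    · exact H1 σ hσ (lt_of_lt_of_le hσlt (min_le_left _ _)) T ρ θ u hE Φ htie t ht htT x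
    · exact H2 σ hσ (lt_of_lt_of_le hσlt (min_le_right _ _)) T ρ θ u hE Φ htie t ht (lt_of_not_ge htT) x
  · obtain ⟨σ₀, hσ₀, H⟩ := h0 η hη a₀ θ₀ u₀ ha hθ hu ha0 hθ0 hdev
    exact ⟨σ₀, hσ₀, H⟩

/-- The same composition concluding the ledger's default copy of the crux decl
(`Theses.ImplosionLoophole.DiluteSelfConsistency`, `Iff.rfl`-equal to the ImplosionDichotomy copy). [folklore] -/
theorem DiluteSelfConsistency_of_loophole
    (h0 : ∀ η : ℝ, 0 < η → ∀ (a₀ θ₀ : T3 → ℝ) (u₀ : T3 → V3), Continuous a₀ → Continuous θ₀ → Continuous u₀ →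
      (∀ x, 0 < a₀ x) → (∀ x, 0 < θ₀ x) →
      (¬ ∃ (T₁ : ℝ) (ρ₁ θ₁ : ℝ → T3 → ℝ) (u₁ : ℝ → T3 → V3), 0 < T₁ ∧ IsHardSphereEulerSolution 0 T₁ ρ₁ u₁ θ₁ ∧
          (∀ x, ρ₁ 0 x = a₀ x / ∫ y, a₀ y) ∧ u₁ 0 = u₀ ∧ θ₁ 0 = θ₀) →
      ∃ σ₀ : ℝ, 0 < σ₀ ∧ DiluteSelfConsistencyHoldsAt η a₀ θ₀ u₀ σ₀)
    (hS : ∀ E ε : ℝ, 0 < ε → ∃ δ : ℝ, 0 < δ ∧ ∀ f : T3 → ℝ, Torus.IsSmooth f →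
      (∫ x, f x ^ 2) ≤ δ →
      (∀ i : Fin 3, (∫ x, Torus.partialDeriv i f x ^ 2) ≤ E) →
      (∀ i j : Fin 3, (∫ x, Torus.partialDeriv i (Torus.partialDeriv j f) x ^ 2) ≤ E) →
      (∀ i j l : Fin 3, (∫ x, Torus.partialDeriv i (Torus.partialDeriv j (Torus.partialDeriv l f)) x ^ 2) ≤ E) →
      ∀ x, |f x| ≤ ε ∧ ∀ i : Fin 3, |Torus.partialDeriv i f x| ≤ ε)
    (hH : ∀ η₀ : ℝ, 0 < η₀ → ∀ F : ℝ → ℝ, AnalyticOnNhd ℝ F (Ioo (-η₀) η₀) →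
      EqOn hsExcessFreeEnergy F (Ico 0 η₀) →
      ∀ M Λ : ℝ, 1 ≤ M → 1 ≤ Λ → ∃ ηP C κ : ℝ, 0 < ηP ∧ 1 ≤ C ∧ 0 ≤ κ ∧
        ∀ σ : ℝ, 0 < σ → ∀ T : ℝ, 0 < T →
        ∀ (ρ θ : ℝ → T3 → ℝ) (u : ℝ → T3 → V3), IsHardSphereEulerSolution σ T ρ u θ →
        (∀ t ∈ Ico 0 T, ∀ x, M⁻¹ ≤ ρ t x ∧ ρ t x ≤ M ∧ M⁻¹ ≤ θ t x ∧ θ t x ≤ M ∧ ‖u t x‖ ≤ Λ ∧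
            ρ t x * σ ^ 3 ≤ ηP ∧
            ∀ i : Fin 3, |Torus.partialDeriv i (ρ t) x| ≤ Λ ∧ ‖Torus.partialDeriv i (u t) x‖ ≤ Λ ∧
              |Torus.partialDeriv i (θ t) x| ≤ Λ) →
        ∀ t ∈ Ico 0 T,
          CompressibleEuler.derivLevelEnergy ρ u θ 3 t ≤
            C * Real.exp (κ * t) * CompressibleEuler.derivLevelEnergy ρ u θ 3 0)
    (hD : ∀ (ρ θ : ℝ → T3 → ℝ) (u : ℝ → T3 → V3) (t B : ℝ), 0 ≤ B →
      Torus.IsSmooth (ρ t) → Torus.IsSmooth (θ t) → Torus.IsSmooth (u t) →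
      (∀ w : List (Fin 3), 1 ≤ w.length → w.length ≤ 3 → ∀ x,
          |Torus.iterPartialDeriv w (ρ t) x| ≤ B ∧ ‖Torus.iterPartialDeriv w (u t) x‖ ≤ B ∧
            |Torus.iterPartialDeriv w (θ t) x| ≤ B) →
      CompressibleEuler.derivLevelEnergy ρ u θ 3 t ≤ 200 * B ^ 2)
    (h2 : ∀ η : ℝ, 0 < η → ∀ (a₀ θ₀ : T3 → ℝ) (u₀ : T3 → V3), Continuous a₀ → Continuous θ₀ → Continuous u₀ →
      (∀ x, 0 < a₀ x) → (∀ x, 0 < θ₀ x) →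
      ∀ (T₁ : ℝ) (ρ₁ θ₁ : ℝ → T3 → ℝ) (u₁ : ℝ → T3 → V3), 0 < T₁ → IsHardSphereEulerSolution 0 T₁ ρ₁ u₁ θ₁ →
        (∀ x, ρ₁ 0 x = a₀ x / ∫ y, a₀ y) → u₁ 0 = u₀ → θ₁ 0 = θ₀ →
        ∃ T₂ : ℝ, 0 < T₂ ∧ T₂ < T₁ ∧ ∃ σ₀ : ℝ, 0 < σ₀ ∧ ∀ σ : ℝ, 0 < σ → σ < σ₀ →
          ∀ (T : ℝ) (ρ θ : ℝ → T3 → ℝ) (u : ℝ → T3 → V3), IsHardSphereEulerSolution σ T ρ u θ →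
            ∀ Φ : (N : ℕ) → HardSphereFlow (Torus.geometry (Fin 3)) (hsDiameter σ N) (N + 1),
              TendstoHydroFieldsAt (fun N => localGibbsLaw σ a₀ u₀ θ₀ N (Φ N)) Φ ρ u θ 0 →
                ∀ t ∈ Ico 0 T, T₂ < t → ∀ x, ρ t x * σ ^ 3 < η) :
    Summit.AtomisticToContinuum.HydrodynamicLimit.Theses.ImplosionLoophole.DiluteSelfConsistency :=
  DiluteSelfConsistency_of h0 hS hH hD h2

/-- **The crux from the six registered stubs** (checker form `<Crux>_proof : <crux decl>`; its axiom closure carries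
`sorryAx` through the open stubs — nothing is claimed closed). [folklore] -/
theorem DiluteSelfConsistency_proof :
    Summit.AtomisticToContinuum.HydrodynamicLimit.Theses.ImplosionDichotomy.DiluteSelfConsistency :=
  DiluteSelfConsistency_of stub_noIdealDevelopmentTrivial stub_smallnessInterpolation stub_uniformDerivEnergy
    stub_derivEnergyDataBound stub_postWindowDilute

/-- Same, for the ledger's default copy of the crux decl (`Theses.ImplosionLoophole`). [folklore] -/
theorem DiluteSelfConsistency_proof_loophole :
    Summit.AtomisticToContinuum.HydrodynamicLimit.Theses.ImplosionLoophole.DiluteSelfConsistency :=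
  DiluteSelfConsistency_of stub_noIdealDevelopmentTrivial stub_smallnessInterpolation stub_uniformDerivEnergy
    stub_derivEnergyDataBound stub_postWindowDilute

end Summit.AtomisticToContinuum.HydrodynamicLimit.Cruxes.DiluteSelfConsistency.Birth

end
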